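import Summits.QuantumFields.BalabanUV.Beta.MixedLetterPacking
import Summits.QuantumFields.BalabanUV.Beta.SecondOrderSocketIdentification

/-!
# `BalabanUV.Beta.SecondOrderTableLawEnd` — binder row D1, (L4): **THE hR ENDs OVER an1's MIXED TABLE LAW** — the packing adapter
# `MixedLetterPacking` (MX2, leaf-05) plugged BY NAME into the border-modelled END and into the row END at the candidate table `vh₂SAn1`
# (β sub-cell, row BETA-an2 = BINDER-OWNERS row D1 OWNER, lineage an2 gen 21, K-P)

HONEST FRAMING (cell charter, verbatim): «discharging BetaPertH makes Balaban's UV stability UNCONDITIONAL — a real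
constructive-QFT result; it is NOT the continuum limit and NOT the Clay problem.»
HONEST DEPENDENCY: continuum YM on T⁴ ⇐ BetaPertH ∧ nine spine estimates (0/9 proved); BetaPertH ⇐ (D1) ∧ (D4) ∧ CAP+tail;
G-an2-4 gates asym, D1 and NE2/3/4.
DERIVED cell leaf ([folklore] kernel bookkeeping + wiring; no statement of Bałaban's papers, no `[cite:]`, no `Prop` fact is minted).
CONDITIONAL WIRING: an1's TABLE-LEVEL mixed reflection law `hM` (MX2's displayed hypothesis, the target of the AVG-LETTERS chain's M4 —
NOT a theorem of the tree) stays a HYPOTHESIS of every END below; so does, in §3, the pure-sign border statement of K-N for the candidate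
row table.  Instantiates no binder of the wall by itself (0∕4: hW, hR, D1Tel, D1Rep).  NOT D1, NOT `BetaPertH`, NOT continuum, NOT Clay.

WHAT (`d + 1 = 4`, odd `Lc`, centred root `ρ_c = toSite (ctrOff 4 Lc)`, pins `(cE, cVH) = (Lc⁴, −Lc⁸∕2)`, `γ₀ = −Lc⁴∕2`, the END's `γ`∕`hγ`,
Λ-lock value `cΛ·Lc⁴ = 2`, `T := T_W = (8N²)⁻¹ • wsym22 N`, `mixFF := mixFFAt ρ_c Lc`):
* §1 [our object] classes of the candidate row table `SecondOrderSocketIdentification.vh₂SAn1` (anti-twin packing of the (g,h)-symmetrised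
  `vh₂SAt ρ_c Lc`): `biLoc_atw`, `atw_shiftK`, **`locStencil₂_vh₂SAn1`** (rate `1∕3`, from an1's `biLoc_vh₂SAt` at both bond orders and the
  triangle inequality) and **`vh₂SAn1_translate`** (from an1's `vh₂SAt_translate`) — the END's `hB`∕`hBt` for `vh₂S := vh₂SAn1`.
* §2 **`axisReflectionCovariant_flipK_TbalOf_JsRecWAtOf_of_tableLaw_model`** (+ `_suN`): hR for the wall literal with the MODEL border
  table `vh₂S := vh₂SModel` ⟸ `hM` ONLY (+ `cΛ·Lc⁴ = 2`, lock2, `cB ≠ 0`): `SecondOrderBorderModelClass.…_of_mixed_letter_model` at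
  `RM₀ := RMof Lc cΛ` with its three mixed binders supplied by `MixedLetterPacking.mixedBinders_of_tableLaw`.
* §3 **`axisReflectionCovariant_flipK_TbalOf_JsRecWAtOf_of_tableLaw_an1`** (+ `_suN`): hR for the ROW literal with `vh₂S := vh₂SAn1 Lc`
  ⟸ `hM` ∧ the PURE-SIGN border statement `∀ α …, (actB_α (cB•vh₂SAn1 − Twall) − (cB•vh₂SAn1 − Twall)) … (inl β) (inr m) = 0`
  (K-N `borderAt_zero_an1_iff`) (+ `cΛ·Lc⁴ = 2`, lock2): `SecondOrderLetterLevels.…_of_an1_letters₀` with every border DATA hypothesis of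
  `vh₂SAn1` discharged here (§1 + K-N's `vh₂SAn1_inl_inl∕_antiTwin∕_inr_inr`).
So after this file the hR binder of row D1 for the literal (T_W, vh₂SAn1, mixFFAt) rests on EXACTLY TWO displayed identities about an1's
averaging tables — the mixed table law `hM` and the border invariance — and on nothing else but `Odd Lc`, the colour basis, lock2, `cΛ·Lc⁴ = 2`.
HONEST: neither identity is proved here; 0∕4 binders.
Provenance: β sub-cell, unit beta-an2 gen 21, 2026-08-20 (v1); no existing file touched.
-/

open Finset
open scoped BigOperators
open Literature.MathematicalPhysics.QuantumFieldTheory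
open Literature.MathematicalPhysics.QuantumFieldTheory.Balaban1983to89
open Literature.MathematicalPhysics.QuantumFieldTheory.Balaban1983to89.Beta
open B12Sec2to5 (l1 l1_nonneg)
open ExpKernelCalculus (MKer BiLoc comp shiftK l1_sub_triangle l1_sub_symm)
open AffineAveraging (box toSite)
open AveragingContoursRooted (ctr ctrOff ctrOff_mem_box)
open AveragingHessianKernelsRooted (hessFFAt linKerAt)
open AveragingMixedJetTables (vh₂SAt mixFFAt vh2Abs vh2Abs_nonneg biLoc_vh₂SAt vh₂SAt_translate)
open PolarizationSign (reflSign AxisReflectionCovariant)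
open KernelReflection (refK refK_apply)
open ResolventReflection (bref Φ)
open OneStepResolventKernel (Fib)
open OneStepKernelFamily (TbalOf flipK)
open ColourTrace (Complete TrOrthonormal)
open WilsonVertex2Sym (wsym22)
open KernelWard (biLoc_add)
open StepJetData (biLoc_weaken biLoc_smul)
open BalabanStepJetsSucc (wE wVH)
open BalabanCompositeJets (LocStencil₂)
open BalabanStepW2 (wV4 wB2)
open SecondOrderResponse (LocStencilFM)
open Summit.QuantumFields.BalabanUV.Beta.TameKernelCalculus
open Summit.QuantumFields.BalabanUV.Beta.ChartConjugation (conjV conjW)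
open Summit.QuantumFields.BalabanUV.Beta.BorderedHessian (diagK ctGen stepScale sgnK)
open Summit.QuantumFields.BalabanUV.Beta.SpineRooted (JsRecWAtOf)
open Summit.QuantumFields.BalabanUV.Beta.MixedJetTablesPlug (hmix_an1)
open Summit.QuantumFields.BalabanUV.Beta.SecondOrderBorderGauge (actB)
open Summit.QuantumFields.BalabanUV.Beta.SecondOrderBorderModel (Twall vh₂SModel)
open Summit.QuantumFields.BalabanUV.Beta.SecondOrderBorderModelClass (locStencil₂_vh₂SModel
  axisReflectionCovariant_flipK_TbalOf_JsRecWAtOf_of_mixed_letter_model axisReflectionCovariant_flipK_TbalOf_JsRecWAtOf_of_mixed_letter_model_suN)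
open Summit.QuantumFields.BalabanUV.Beta.SecondOrderLetterLevels (BorderPrim BorderAt MixedPrim border_prim_of_zero
  axisReflectionCovariant_flipK_TbalOf_JsRecWAtOf_of_an1_letters₀ axisReflectionCovariant_flipK_TbalOf_JsRecWAtOf_of_an1_letters₀_suN)
open Summit.QuantumFields.BalabanUV.Beta.SecondOrderSocketIdentification (atw vh₂SAn1 vh₂SAn1_inl_inl vh₂SAn1_inr_inr vh₂SAn1_antiTwin
  borderAt_zero_an1_iff)
open Summit.QuantumFields.BalabanUV.Beta.MixedLetterPacking (RMof mixedBinders_of_tableLaw)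

namespace Summit.QuantumFields.BalabanUV.Beta.SecondOrderTableLawEnd

noncomputable section

/-! ## §1 Classes of the candidate row table `vh₂SAn1` -/

section Classes

variable {d : ℕ}

/-- [folklore] The anti-twin projection preserves bi-localisation at a diagonal point (its `(inr, inl)` block is minus the TRANSPOSED
`(inl, inr)` block, and the weight `e^{−δ(|x−u|+|z−u|)}` is symmetric in `x, z`). -/
theorem biLoc_atw {K : MKer (d + 1) (Fib d)} {u : Fin (d + 1) → ℤ} {C δ : ℝ} (h : BiLoc K u u C δ) (hC : 0 ≤ C) :
    BiLoc (atw K) u u C δ := by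
  intro x z a b
  have hpos : 0 ≤ C * Real.exp (-δ * (l1 (x - u) + l1 (z - u))) := mul_nonneg hC (Real.exp_pos _).le
  rcases a with β | m <;> rcases b with β' | m'
  · simp only [atw, abs_zero]; exact hpos
  · exact h x z (Sum.inl β) (Sum.inr m')
  · have h' := h z x (Sum.inl β') (Sum.inr m)
    simp only [atw, abs_neg]
    rw [add_comm (l1 (x - u))]
    exact h'
  · simp only [atw, abs_zero]; exact hpos

/-- [folklore] The anti-twin projection commutes with simultaneous translation of both kernel legs. -/
theorem atw_shiftK (v : Fin (d + 1) → ℤ) (K : MKer (d + 1) (Fib d)) : atw (shiftK v K) = shiftK v (atw K) := by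
  funext x z a b
  rcases a with β | m <;> rcases b with β' | m' <;> rfl

/-- [folklore] A kernel bi-localised at `(u′, u′)` with the far factor `e^{−δ|u−u′|}` is bi-localised at `(u, u)` with far factor
`e^{−(δ∕3)|u′−u|}` at rate `δ∕3` (re-centring both legs costs `2·(δ∕3)·|u′−u|`, paid by the far factor; GAN24's `locStencil₂_swapT` count). -/
theorem biLoc_recentre {K : MKer (d + 1) (Fib d)} {u u' : Fin (d + 1) → ℤ} {C δ : ℝ} (hC : 0 ≤ C) (hδ : 0 ≤ δ)
    (h : BiLoc K u' u' (C * Real.exp (-δ * l1 (u - u'))) δ) :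
    BiLoc K u u (C * Real.exp (-(δ / 3) * l1 (u' - u))) (δ / 3) := by
  intro x z a b
  refine (h x z a b).trans ?_
  rw [mul_assoc, mul_assoc]
  refine mul_le_mul_of_nonneg_left ?_ hC
  rw [← Real.exp_add, ← Real.exp_add, Real.exp_le_exp]
  have tx := l1_sub_triangle x u' u
  have tz := l1_sub_triangle z u' u
  have e : l1 (u - u') = l1 (u' - u) := l1_sub_symm u u'
  rw [e]
  nlinarith [l1_nonneg (x - u'), l1_nonneg (z - u'), l1_nonneg (u' - u), l1_nonneg (x - u), l1_nonneg (z - u)]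

end Classes

section Wall

variable {Lc : ℕ} [NeZero Lc]

omit [NeZero Lc] in
/-- [folklore] **THE CANDIDATE ROW TABLE IS A `LocStencil₂` FAMILY** (the END's `hB` for `vh₂S := vh₂SAn1 Lc`): rate `1∕3`, constant
`vh2Abs ρ_c Lc · e^{6·4·Lc}` — an1's `biLoc_vh₂SAt` (rate `1`) at both bond orders, the swapped one re-centred (`biLoc_recentre`), averaged, and
packed anti-twin (`biLoc_atw`). -/
theorem locStencil₂_vh₂SAn1 (hLc : Odd Lc) : ∃ C δ : ℝ, 0 < δ ∧ LocStencil₂ (vh₂SAn1 Lc) C δ := by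
  have hr := ctrOff_mem_box (d := 4) hLc.pos
  set A : ℝ := vh2Abs (toSite (ctrOff 4 Lc)) Lc * Real.exp (6 * ((3 : ℝ) + 1) * Lc * 1) with hA
  have hA0 : 0 ≤ A := by rw [hA]; exact mul_nonneg (vh2Abs_nonneg _ _) (Real.exp_pos _).le
  refine ⟨A, 1 / 3, by norm_num, fun κ u κ' u' => ?_⟩
  have h1 : BiLoc (vh₂SAt (toSite (ctrOff 4 Lc)) Lc κ u κ' u') u u (A * Real.exp (-(1 : ℝ) * l1 (u' - u))) 1 := by
    rw [hA]; exact biLoc_vh₂SAt (d := 3) hLc.pos hr zero_le_one κ u κ' u'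
  have h2 : BiLoc (vh₂SAt (toSite (ctrOff 4 Lc)) Lc κ' u' κ u) u' u' (A * Real.exp (-(1 : ℝ) * l1 (u - u'))) 1 := by
    rw [hA]; exact biLoc_vh₂SAt (d := 3) hLc.pos hr zero_le_one κ' u' κ u
  have h2' := biLoc_recentre hA0 zero_le_one h2
  have h1' : BiLoc (vh₂SAt (toSite (ctrOff 4 Lc)) Lc κ u κ' u') u u (A * Real.exp (-(1 / 3 : ℝ) * l1 (u' - u))) (1 / 3) := by
    refine biLoc_weaken h1 ?_ (by norm_num)
    refine mul_le_mul_of_nonneg_left ?_ hA0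
    rw [Real.exp_le_exp]
    nlinarith [l1_nonneg (u' - u)]
  have hsum := biLoc_smul (biLoc_add h1' h2') (1 / 2 : ℝ)
  have e : |(1 / 2 : ℝ)| * (A * Real.exp (-(1 / 3 : ℝ) * l1 (u' - u)) + A * Real.exp (-((1 : ℝ) / 3) * l1 (u' - u)))
      = A * Real.exp (-(1 / 3 : ℝ) * l1 (u' - u)) := by
    rw [abs_of_pos (by norm_num : (0 : ℝ) < 1 / 2)]; ring
  rw [e] at hsum
  exact biLoc_atw hsum (mul_nonneg hA0 (Real.exp_pos _).le)

omit [NeZero Lc] in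
/-- [folklore] **BLOCK-TRANSLATION COVARIANCE OF THE CANDIDATE ROW TABLE** (the END's `hBt` for `vh₂S := vh₂SAn1 Lc`), from an1's
`vh₂SAt_translate` at both bond orders. -/
theorem vh₂SAn1_translate (hLc : 1 ≤ Lc) (κ : Fin 4) (u : Fin 4 → ℤ) (κ' : Fin 4) (u' t : Fin 4 → ℤ) :
    vh₂SAn1 Lc κ (u + (Lc : ℤ) • t) κ' (u' + (Lc : ℤ) • t) = shiftK (-((Lc : ℤ) • t)) (vh₂SAn1 Lc κ u κ' u') := by
  unfold vh₂SAn1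
  rw [vh₂SAt_translate hLc, vh₂SAt_translate hLc, ← atw_shiftK]
  rfl

/-! ## §2 hR for the wall literal with the MODEL border table ⟸ an1's mixed table law only -/

/-- [folklore] **hR(v2.26-W, T := (8N²)⁻¹•wsym22 N, vh₂S := vh₂SModel, mixFF := mixFFAt ρ_c Lc) ⟸ an1's TABLE-LEVEL MIXED LAW `hM` ONLY**
(+ the Λ-lock value `cΛ·Lc⁴ = 2`, lock2, `cB ≠ 0`): `SecondOrderBorderModelClass.…_of_mixed_letter_model` at `RM₀ := RMof Lc cΛ`, its three
mixed binders (`hM₀`, `hRM₀c`, `hRM₀p`) being `MixedLetterPacking.mixedBinders_of_tableLaw hLc hΛ hM`.  CONDITIONAL on `hM`. -/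
theorem axisReflectionCovariant_flipK_TbalOf_JsRecWAtOf_of_tableLaw_model (hLc : Odd Lc) {N : ℕ} {C : Type*} [Fintype C]
    [DecidableEq C] {τ : C → Matrix (Fin N) (Fin N) ℂ} (hτ : Complete τ) (ho : TrOrthonormal τ) (hN : N ≠ 0) (c : C) {cΛ : ℝ}
    (hΛ : cΛ * (Lc : ℝ) ^ 4 = 2) (cE₂ cB : ℝ) (hcB : cB ≠ 0) (γ : ℕ → ℝ)
    (hγ : ∀ j, γ j = -((Lc : ℝ) ^ 8 / 2) * wVH 3 Lc j / (stepScale 3 Lc j * (Lc : ℝ) ^ 4))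
    (hlock2 : ∀ j, cE₂ * wV4 3 Lc (j + 1) * wVH 3 Lc (j + 1) = ((Lc : ℝ) ^ 4 * wE 3 Lc (j + 1)) ^ 2)
    -- an1's TABLE-LEVEL MIXED REFLECTION LAW (hypothesis; MX2's displayed form)
    (hM : ∀ (α κ : Fin 4) (u : Fin 4 → ℤ) (ρ' : Fin 4) (w : Fin 4 → ℤ),
      mixFFAt (toSite (ctrOff 4 Lc)) Lc κ (bref α κ u) ρ' (bref α ρ' w) =
        (reflSign α κ * reflSign α ρ') • refK (Φ Lc α)
          (mixFFAt (toSite (ctrOff 4 Lc)) Lc κ u ρ' w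
            + (2 : ℝ) • comp (diagK (ctGen 3 α Lc κ u)) (hessFFAt (toSite (ctrOff 4 Lc)) Lc ρ' w)
            + (2 * (if ρ' = α then linKerAt (toSite (ctrOff 4 Lc)) Lc ρ' w (κ, u) else 0)) • hessFFAt (toSite (ctrOff 4 Lc)) Lc ρ' w)) :
    ∀ j : ℕ, AxisReflectionCovariant
      (flipK (TbalOf Lc (JsRecWAtOf (d := 3) hLc.pos (ctrOff_mem_box hLc.pos) ((Lc : ℝ) ^ 4) (-((Lc : ℝ) ^ 8 / 2)) cΛ cE₂ cB
        ((8 * (N : ℝ) ^ 2)⁻¹ • wsym22 N) (locStencil₂_vh₂SModel hLc cΛ cB γ) (hmix_an1 (d := 3) hLc.pos (ctrOff_mem_box hLc.pos))) j)) := by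
  obtain ⟨hM₀, hRM₀c, hRM₀p⟩ := mixedBinders_of_tableLaw hLc hΛ hM
  exact axisReflectionCovariant_flipK_TbalOf_JsRecWAtOf_of_mixed_letter_model hLc hτ ho hN c cΛ cE₂ cB hcB γ hγ hlock2 (RMof Lc cΛ)
    hM₀ hRM₀c hRM₀p

/-- [folklore] **THE `SU(N)` INSTANCE, `N ≥ 2`**, model border table, ⟸ `hM` only (+ `cΛ·Lc⁴ = 2`, lock2, `cB ≠ 0`). -/
theorem axisReflectionCovariant_flipK_TbalOf_JsRecWAtOf_of_tableLaw_model_suN (hLc : Odd Lc) {N : ℕ} (hN : 2 ≤ N) {cΛ : ℝ}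
    (hΛ : cΛ * (Lc : ℝ) ^ 4 = 2) (cE₂ cB : ℝ) (hcB : cB ≠ 0) (γ : ℕ → ℝ)
    (hγ : ∀ j, γ j = -((Lc : ℝ) ^ 8 / 2) * wVH 3 Lc j / (stepScale 3 Lc j * (Lc : ℝ) ^ 4))
    (hlock2 : ∀ j, cE₂ * wV4 3 Lc (j + 1) * wVH 3 Lc (j + 1) = ((Lc : ℝ) ^ 4 * wE 3 Lc (j + 1)) ^ 2)
    (hM : ∀ (α κ : Fin 4) (u : Fin 4 → ℤ) (ρ' : Fin 4) (w : Fin 4 → ℤ),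
      mixFFAt (toSite (ctrOff 4 Lc)) Lc κ (bref α κ u) ρ' (bref α ρ' w) =
        (reflSign α κ * reflSign α ρ') • refK (Φ Lc α)
          (mixFFAt (toSite (ctrOff 4 Lc)) Lc κ u ρ' w
            + (2 : ℝ) • comp (diagK (ctGen 3 α Lc κ u)) (hessFFAt (toSite (ctrOff 4 Lc)) Lc ρ' w)
            + (2 * (if ρ' = α then linKerAt (toSite (ctrOff 4 Lc)) Lc ρ' w (κ, u) else 0)) • hessFFAt (toSite (ctrOff 4 Lc)) Lc ρ' w)) :
    ∀ j : ℕ, AxisReflectionCovariant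
      (flipK (TbalOf Lc (JsRecWAtOf (d := 3) hLc.pos (ctrOff_mem_box hLc.pos) ((Lc : ℝ) ^ 4) (-((Lc : ℝ) ^ 8 / 2)) cΛ cE₂ cB
        ((8 * (N : ℝ) ^ 2)⁻¹ • wsym22 N) (locStencil₂_vh₂SModel hLc cΛ cB γ) (hmix_an1 (d := 3) hLc.pos (ctrOff_mem_box hLc.pos))) j)) := by
  obtain ⟨hM₀, hRM₀c, hRM₀p⟩ := mixedBinders_of_tableLaw hLc hΛ hM
  exact axisReflectionCovariant_flipK_TbalOf_JsRecWAtOf_of_mixed_letter_model_suN hLc hN cΛ cE₂ cB hcB γ hγ hlock2 (RMof Lc cΛ)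
    hM₀ hRM₀c hRM₀p

/-! ## §3 hR for the ROW literal with the candidate table `vh₂SAn1` ⟸ an1's mixed table law ∧ the pure-sign border statement -/

/-- [folklore] **hR(v2.26-W, T := (8N²)⁻¹•wsym22 N, vh₂S := vh₂SAn1 Lc, mixFF := mixFFAt ρ_c Lc) ⟸ EXACTLY TWO DISPLAYED IDENTITIES about an1's
averaging tables**: the table-level mixed law `hM` and the pure-sign border statement `hInv` («`cB•vh₂SAn1 − Twall` is `actB`-invariant on the
field–multiplier block under all four axes», K-N `borderAt_zero_an1_iff`) (+ `cΛ·Lc⁴ = 2`, lock2): `SecondOrderLetterLevels.…_of_an1_letters₀` with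
its border DATA hypotheses discharged (`locStencil₂_vh₂SAn1`, `vh₂SAn1_inl_inl∕_antiTwin∕_inr_inr`, `vh₂SAn1_translate`) and (B₀) := `hInv` through
`borderAt_zero_an1_iff` + `border_prim_of_zero`.  CONDITIONAL on `hM` and `hInv`; neither is proved in the tree. -/
theorem axisReflectionCovariant_flipK_TbalOf_JsRecWAtOf_of_tableLaw_an1 (hLc : Odd Lc) {N : ℕ} {C : Type*} [Fintype C]
    [DecidableEq C] {τ : C → Matrix (Fin N) (Fin N) ℂ} (hτ : Complete τ) (ho : TrOrthonormal τ) (hN : N ≠ 0) (c : C) {cΛ : ℝ}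
    (hΛ : cΛ * (Lc : ℝ) ^ 4 = 2) (cE₂ cB : ℝ) (γ : ℕ → ℝ)
    (hγ : ∀ j, γ j = -((Lc : ℝ) ^ 8 / 2) * wVH 3 Lc j / (stepScale 3 Lc j * (Lc : ℝ) ^ 4))
    (hlock2 : ∀ j, cE₂ * wV4 3 Lc (j + 1) * wVH 3 Lc (j + 1) = ((Lc : ℝ) ^ 4 * wE 3 Lc (j + 1)) ^ 2)
    -- an1's TABLE-LEVEL MIXED REFLECTION LAW (hypothesis; MX2's displayed form)
    (hM : ∀ (α κ : Fin 4) (u : Fin 4 → ℤ) (ρ' : Fin 4) (w : Fin 4 → ℤ),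
      mixFFAt (toSite (ctrOff 4 Lc)) Lc κ (bref α κ u) ρ' (bref α ρ' w) =
        (reflSign α κ * reflSign α ρ') • refK (Φ Lc α)
          (mixFFAt (toSite (ctrOff 4 Lc)) Lc κ u ρ' w
            + (2 : ℝ) • comp (diagK (ctGen 3 α Lc κ u)) (hessFFAt (toSite (ctrOff 4 Lc)) Lc ρ' w)
            + (2 * (if ρ' = α then linKerAt (toSite (ctrOff 4 Lc)) Lc ρ' w (κ, u) else 0)) • hessFFAt (toSite (ctrOff 4 Lc)) Lc ρ' w))
    -- THE PURE-SIGN BORDER STATEMENT for the candidate row table (hypothesis; K-N's re-typing of (B₀))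
    (hInv : ∀ (α κ : Fin 4) (u : Fin 4 → ℤ) (κ' : Fin 4) (u' x z : Fin 4 → ℤ) (β m : Fin 4),
      (actB Lc α (cB • vh₂SAn1 Lc - Twall Lc cΛ γ) - (cB • vh₂SAn1 Lc - Twall Lc cΛ γ)) κ u κ' u' x z (Sum.inl β) (Sum.inr m) = 0) :
    ∀ j : ℕ, AxisReflectionCovariant
      (flipK (TbalOf Lc (JsRecWAtOf (d := 3) hLc.pos (ctrOff_mem_box hLc.pos) ((Lc : ℝ) ^ 4) (-((Lc : ℝ) ^ 8 / 2)) cΛ cE₂ cB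
        ((8 * (N : ℝ) ^ 2)⁻¹ • wsym22 N) (locStencil₂_vh₂SAn1 hLc) (hmix_an1 (d := 3) hLc.pos (ctrOff_mem_box hLc.pos))) j)) := by
  obtain ⟨hM₀, hRM₀c, hRM₀p⟩ := mixedBinders_of_tableLaw hLc hΛ hM
  have hB₀ : BorderPrim Lc (toSite (ctrOff 4 Lc)) cB (vh₂SAn1 Lc) :=
    border_prim_of_zero (toSite (ctrOff 4 Lc)) cΛ cB hγ ((borderAt_zero_an1_iff hLc cΛ cB γ hγ).2 hInv)
  exact axisReflectionCovariant_flipK_TbalOf_JsRecWAtOf_of_an1_letters₀ hLc hτ ho hN c cΛ cE₂ cB (locStencil₂_vh₂SAn1 hLc)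
    (vh₂SAn1_inl_inl (Lc := Lc)) γ hγ hlock2 (RMof Lc cΛ) hM₀ hRM₀c hRM₀p (vh₂SAn1_antiTwin (Lc := Lc)) (vh₂SAn1_inr_inr (Lc := Lc)) hB₀
    (vh₂SAn1_translate hLc.pos)

/-- [folklore] **THE `SU(N)` INSTANCE, `N ≥ 2`**, row literal at `vh₂SAn1`, ⟸ `hM` ∧ `hInv` (+ `cΛ·Lc⁴ = 2`, lock2). -/
theorem axisReflectionCovariant_flipK_TbalOf_JsRecWAtOf_of_tableLaw_an1_suN (hLc : Odd Lc) {N : ℕ} (hN : 2 ≤ N) {cΛ : ℝ}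
    (hΛ : cΛ * (Lc : ℝ) ^ 4 = 2) (cE₂ cB : ℝ) (γ : ℕ → ℝ)
    (hγ : ∀ j, γ j = -((Lc : ℝ) ^ 8 / 2) * wVH 3 Lc j / (stepScale 3 Lc j * (Lc : ℝ) ^ 4))
    (hlock2 : ∀ j, cE₂ * wV4 3 Lc (j + 1) * wVH 3 Lc (j + 1) = ((Lc : ℝ) ^ 4 * wE 3 Lc (j + 1)) ^ 2)
    (hM : ∀ (α κ : Fin 4) (u : Fin 4 → ℤ) (ρ' : Fin 4) (w : Fin 4 → ℤ),
      mixFFAt (toSite (ctrOff 4 Lc)) Lc κ (bref α κ u) ρ' (bref α ρ' w) =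
        (reflSign α κ * reflSign α ρ') • refK (Φ Lc α)
          (mixFFAt (toSite (ctrOff 4 Lc)) Lc κ u ρ' w
            + (2 : ℝ) • comp (diagK (ctGen 3 α Lc κ u)) (hessFFAt (toSite (ctrOff 4 Lc)) Lc ρ' w)
            + (2 * (if ρ' = α then linKerAt (toSite (ctrOff 4 Lc)) Lc ρ' w (κ, u) else 0)) • hessFFAt (toSite (ctrOff 4 Lc)) Lc ρ' w))
    (hInv : ∀ (α κ : Fin 4) (u : Fin 4 → ℤ) (κ' : Fin 4) (u' x z : Fin 4 → ℤ) (β m : Fin 4),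
      (actB Lc α (cB • vh₂SAn1 Lc - Twall Lc cΛ γ) - (cB • vh₂SAn1 Lc - Twall Lc cΛ γ)) κ u κ' u' x z (Sum.inl β) (Sum.inr m) = 0) :
    ∀ j : ℕ, AxisReflectionCovariant
      (flipK (TbalOf Lc (JsRecWAtOf (d := 3) hLc.pos (ctrOff_mem_box hLc.pos) ((Lc : ℝ) ^ 4) (-((Lc : ℝ) ^ 8 / 2)) cΛ cE₂ cB
        ((8 * (N : ℝ) ^ 2)⁻¹ • wsym22 N) (locStencil₂_vh₂SAn1 hLc) (hmix_an1 (d := 3) hLc.pos (ctrOff_mem_box hLc.pos))) j)) := by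
  obtain ⟨hM₀, hRM₀c, hRM₀p⟩ := mixedBinders_of_tableLaw hLc hΛ hM
  have hB₀ : BorderPrim Lc (toSite (ctrOff 4 Lc)) cB (vh₂SAn1 Lc) :=
    border_prim_of_zero (toSite (ctrOff 4 Lc)) cΛ cB hγ ((borderAt_zero_an1_iff hLc cΛ cB γ hγ).2 hInv)
  exact axisReflectionCovariant_flipK_TbalOf_JsRecWAtOf_of_an1_letters₀_suN hLc hN cΛ cE₂ cB (locStencil₂_vh₂SAn1 hLc)
    (vh₂SAn1_inl_inl (Lc := Lc)) γ hγ hlock2 (RMof Lc cΛ) hM₀ hRM₀c hRM₀p (vh₂SAn1_antiTwin (Lc := Lc)) (vh₂SAn1_inr_inr (Lc := Lc)) hB₀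
    (vh₂SAn1_translate hLc.pos)

end Wall

end

end Summit.QuantumFields.BalabanUV.Beta.SecondOrderTableLawEnd
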